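import Summits.QuantumFields.BalabanUV.T4Continuum.Support.NE3EnergyHessTwoTerm
import Summits.QuantumFields.BalabanUV.T4Continuum.Support.NE3CurlStability

/-!
# T⁴ programme, node NE3, route P2 «ENERGY CONVEXITY» — sub-row S5-Y8a part 1c, file 2∕2: THE TWO-TERM CONTINUITY
# BOUND AT THE FIXED BACKGROUND (curl transported along the path by P3's first-order stability) and its weighted display

NE3 formalisation swarm `b2b-balaban-t4-ne3-formalise-*`, unit `b2b-balaban-t4-ne3-formalise-leaf-03` (gen 4), sub-row
**S5-Y8a-1c** of `t4/formal/NE3/LEAVES.md` (journal INTENT 2026-08-20T10:38Z), second file.  File 1 (`NE3EnergyHessTwoTerm`)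
gives, at ONE configuration `V` with plaquette radius `a`,
`|hessSym V (perWin d M) Y Z| ≤ √curlSq(V,Y)·√curlSq(V,Z) + 48·d·a·√dirSq Y·√dirSq Z`.  Along the path of
`NE3EnergyAssembly.RouteLeaves` the configuration MOVES (`W_t = W·e^{tX}`) while the norm is taken at the FIXED background
`W`; THIS FILE transports the curl term ([folklore]; 0 `def`, 0 sorry):
* §2 `sqrt_sum_sq_add_le` (finite Minkowski), **`sqrt_curlSq_vary_le`**:
  `√curlSq(W·e^{tX}, Y) ≤ √curlSq(W, Y) + 24·√d·δ·√dirSq Y`, `δ = e^{|t|α} − 1`, for unitary `W`, skew `X` with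
  `‖X(b)‖ ≤ α` (`α ≥ 0`), periodic `Y` — over P3's `NE3CurlStability.norm_curl_vary_sub_le` BY NAME;
* §3 **`abs_hessSym_perWin_vary_le_twoTerm`** —
  `|hessSym (W·e^{tX}) (perWin d M) Y Z| ≤ (√curlSq(W,Y) + 24√d·δ·√dirSq Y)(√curlSq(W,Z) + 24√d·δ·√dirSq Z) + 48·d·a′·√dirSq Y·√dirSq Z`,
  the MOVING configuration's plaquette radius `a′` a HYPOTHESIS (crudely `a′ ≤ a_W + 4δ` by `NE3EnergyVary.smallField_vary`;
  sharply `a′ ≤ a_W + sup‖d_W X‖ + O(α²)` by a curl-refined small-field lemma — NOT here), and the NORM-AGNOSTIC weighted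
  display **`abs_hessSym_perWin_vary_le_weighted`**: for every `s > 0`,
  `|…| ≤ [(1 + 24√d·δ·s)² + 48·d·a′·s²]·√(curlSq W Y + dirSq Y∕s²)·√(curlSq W Z + dirSq Z∕s²)` — with `s = L^k` the
  constant is k-FREE as soon as `δ·L^k` (chart sup-radius) and `a′·L^{2k}` (background + chart curl-radius) are bounded:
  the Λ-half of FINDING-INFO-1 reduced to two DISPLAYED smallness data of the chart path, stated not asserted;
* §4 **`cont_twoTerm_periodic`** — the path form along `W_t = vary W (Γ t) 1`, `t ∈ [0,1]`, in `HsPer` form for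
  PERIODIC directions.  HONEST LIMIT: for non-periodic `Y` the device `HsPer = hessSym ∘ perExt` does not carry
  `curlSq W Y (periodBox)` across the box boundary (only `dirSq` is extension-invariant), so the bound is stated on periodic
  directions; which quantifier a re-typed `cont` takes is the single writers' call (LEAVES ρ19).

HONEST FRAMING.  As file 1: finite-T⁴ bookkeeping; matrix inequalities; NOTHING about minimisers; no coercivity stated
or consumed, no norm chosen; no conditional of the cell; NOT infinite volume ∕ mass gap ∕ Clay ∕ summit progress;
**NE3 is NOT proved**; NE3-E CONDITIONAL on ⟨named structures⟩; spine PROVED 0∕9.  ABSOLUTE RULE kept.  PLACEMENT: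
`Summits/QuantumFields/BalabanUV/`; imports file 1 and road P3's `Support.NE3CurlStability` (p214150) BY NAME.
-/


set_option autoImplicit false

open scoped BigOperators Matrix.Norms.L2Operator
open NormedSpace Finset

namespace Summit.QuantumFields.BalabanUV.T4Continuum.NE3EnergyHessContTwoTerm

open Literature.MathematicalPhysics.QuantumFieldTheory.Balaban1983to89
open B7Prop1Explicit B7Prop2Explicit MatrixLog UnitaryModel
open T4AveragingDeficitWall hiding Site Plane Plaq Bond
open T4AveragingDeficitWallBoundary (periodBox)
open AveragingDeficitPeriodicCounting (IsPeriodicDir)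
open AveragingDeficitNearIdentity (abs_nReTr_mul_le)
open MinimalActionLevels (perWin)
open NE3HessForm (dcurlAt hessPlaqAt hess)
open NE3HessBounds (bondSq bondSqAt nReTr_Ad_comm norm_curlAt_le)
open NE3HessContinuity (bondL1At bondL1 bondL1At_nonneg bondL1At_sq_le norm_dcurlAt_le)
open NE3HessShapes (plaqsOf curlSq_eq_sum_plaqsOf sum_plaqsOf_bondSq_le)
open NE3EnergyHessBilin (hessSym hessSym_apply)
open NE3EnergyHessCont (HsPer HsPer_apply_of_periodic perWin_eq_plaqsOf)
open NE3EnergyHessTwoTerm (abs_hessSym_perWin_le_twoTerm)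
open NE3CurlStability (norm_curl_vary_sub_le)
open AveragingDeficitPlaqDeriv (vary_isUnitaryCfg)

noncomputable section

variable {d : ℕ} {n : Type*} [Fintype n] [DecidableEq n]

/-! ## §2 Curl transport to the fixed background along `W·e^{tX}` (P3's first-order stability BY NAME) -/

/-- FINITE MINKOWSKI: `√(Σ (f+g)²) ≤ √(Σ f²) + √(Σ g²)`. [folklore] -/
theorem sqrt_sum_sq_add_le {ι : Type*} (s : Finset ι) (f g : ι → ℝ) :
    Real.sqrt (∑ i ∈ s, (f i + g i) ^ 2) ≤ Real.sqrt (∑ i ∈ s, f i ^ 2) + Real.sqrt (∑ i ∈ s, g i ^ 2) := by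
  set A := Real.sqrt (∑ i ∈ s, f i ^ 2) with hA
  set B := Real.sqrt (∑ i ∈ s, g i ^ 2) with hB
  have hA0 : 0 ≤ A := Real.sqrt_nonneg _
  have hB0 : 0 ≤ B := Real.sqrt_nonneg _
  have hF0 : 0 ≤ ∑ i ∈ s, f i ^ 2 := Finset.sum_nonneg fun i _ => sq_nonneg _
  have hG0 : 0 ≤ ∑ i ∈ s, g i ^ 2 := Finset.sum_nonneg fun i _ => sq_nonneg _
  have hcs : (∑ i ∈ s, f i * g i) ^ 2 ≤ (∑ i ∈ s, f i ^ 2) * (∑ i ∈ s, g i ^ 2) :=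
    Finset.sum_mul_sq_le_sq_mul_sq s f g
  have hfg : ∑ i ∈ s, f i * g i ≤ A * B := by
    have h1 : ∑ i ∈ s, f i * g i ≤ |∑ i ∈ s, f i * g i| := le_abs_self _
    have h2 : |∑ i ∈ s, f i * g i| ≤ A * B := by
      rw [hA, hB, ← Real.sqrt_mul hF0, ← Real.sqrt_sq_eq_abs]
      exact Real.sqrt_le_sqrt hcs
    exact h1.trans h2
  have hexp : ∑ i ∈ s, (f i + g i) ^ 2 = (∑ i ∈ s, f i ^ 2) + 2 * (∑ i ∈ s, f i * g i) + ∑ i ∈ s, g i ^ 2 := by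
    rw [Finset.mul_sum, ← Finset.sum_add_distrib, ← Finset.sum_add_distrib]
    exact Finset.sum_congr rfl fun i _ => by ring
  have hsq : ∑ i ∈ s, (f i + g i) ^ 2 ≤ (A + B) ^ 2 := by
    rw [hexp, add_sq, hA, Real.sq_sqrt hF0, hB, Real.sq_sqrt hG0, ← hA, ← hB]
    linarith
  calc Real.sqrt (∑ i ∈ s, (f i + g i) ^ 2) ≤ Real.sqrt ((A + B) ^ 2) := Real.sqrt_le_sqrt hsq
    _ = A + B := Real.sqrt_sq (add_nonneg hA0 hB0)

/-- Monotone square roots of sums of squares of NON-NEGATIVE terms: `0 ≤ u ≤ v` termwise ⟹ `√Σu² ≤ √Σv²`. [folklore] -/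
theorem sqrt_sum_sq_mono {ι : Type*} (s : Finset ι) {u v : ι → ℝ} (hu : ∀ i ∈ s, 0 ≤ u i) (huv : ∀ i ∈ s, u i ≤ v i) :
    Real.sqrt (∑ i ∈ s, u i ^ 2) ≤ Real.sqrt (∑ i ∈ s, v i ^ 2) :=
  Real.sqrt_le_sqrt (Finset.sum_le_sum fun i hi => pow_le_pow_left₀ (hu i hi) (huv i hi) 2)

/-- **CURL TRANSPORT ON A WINDOW**: for unitary `W`, skew `X` with `‖X(b)‖ ≤ α` and `δ := e^{|t|α} − 1`,
`√(Σ_{p∈Wn}‖d_{W e^{tX}} Y(p)‖²) ≤ √(Σ_{p∈Wn}‖d_W Y(p)‖²) + 12·δ·√(Σ_{p∈Wn} bondSq Y p)`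
(P3's `NE3CurlStability.norm_curl_vary_sub_le` plaquette by plaquette, Minkowski, `bondL1² ≤ 4·bondSq`). [folklore] -/
theorem sqrt_sum_curl_sq_vary_le [Nonempty n] {W : Site d → Fin d → (Matrix n n ℂ)ˣ} (hW : IsUnitaryCfg W)
    {X : Site d → Fin d → Matrix n n ℂ} (hX : IsSkewDir X) {α : ℝ} (hα : 0 ≤ α) (hXα : ∀ x κ, ‖X x κ‖ ≤ α) (t : ℝ)
    (Y : Site d → Fin d → Matrix n n ℂ) (Wn : Finset (T4AveragingDeficitWall.Plaq d)) :
    Real.sqrt (∑ p ∈ Wn, ‖curl (vary W X t) Y p‖ ^ 2)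
      ≤ Real.sqrt (∑ p ∈ Wn, ‖curl W Y p‖ ^ 2)
        + 12 * (Real.exp (|t| * α) - 1) * Real.sqrt (∑ p ∈ Wn, bondSq Y p) := by
  set δ := Real.exp (|t| * α) - 1 with hδ
  have hδ0 : 0 ≤ δ := by
    have : 0 ≤ |t| * α := mul_nonneg (abs_nonneg t) hα
    have := Real.one_le_exp this
    rw [hδ]; linarith
  -- termwise: ‖curl_t‖ ≤ ‖curl‖ + 6δ·bondL1
  have hterm : ∀ p ∈ Wn, ‖curl (vary W X t) Y p‖ ≤ ‖curl W Y p‖ + 6 * δ * bondL1 Y p := by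
    intro p _
    have h := norm_curl_vary_sub_le hW hX hXα t Y p
    calc ‖curl (vary W X t) Y p‖ = ‖curl W Y p + (curl (vary W X t) Y p - curl W Y p)‖ := by rw [add_sub_cancel]
      _ ≤ ‖curl W Y p‖ + ‖curl (vary W X t) Y p - curl W Y p‖ := norm_add_le _ _
      _ ≤ ‖curl W Y p‖ + 6 * δ * bondL1 Y p := by linarith
  have hstep1 : Real.sqrt (∑ p ∈ Wn, ‖curl (vary W X t) Y p‖ ^ 2)
      ≤ Real.sqrt (∑ p ∈ Wn, (‖curl W Y p‖ + 6 * δ * bondL1 Y p) ^ 2) :=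
    sqrt_sum_sq_mono Wn (fun p _ => norm_nonneg _) hterm
  have hstep2 := sqrt_sum_sq_add_le Wn (fun p => ‖curl W Y p‖) (fun p => 6 * δ * bondL1 Y p)
  -- the bondL1 part: `√Σ(6δ·bondL1)² = 6δ·√Σ bondL1² ≤ 6δ·2·√Σ bondSq`
  have hL : ∑ p ∈ Wn, (6 * δ * bondL1 Y p) ^ 2 = (6 * δ) ^ 2 * ∑ p ∈ Wn, bondL1 Y p ^ 2 := by
    rw [Finset.mul_sum]; exact Finset.sum_congr rfl fun p _ => by ring
  have hY4 : ∑ p ∈ Wn, bondL1 Y p ^ 2 ≤ 4 * ∑ p ∈ Wn, bondSq Y p := by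
    rw [Finset.mul_sum]; exact Finset.sum_le_sum fun p _ => bondL1At_sq_le Y p.1 p.2.1.1 p.2.1.2
  have hsqrt4 : Real.sqrt 4 = 2 := by
    rw [show (4 : ℝ) = 2 ^ 2 by norm_num, Real.sqrt_sq (by norm_num)]
  have h6δ : 0 ≤ 6 * δ := by positivity
  have hbond : Real.sqrt (∑ p ∈ Wn, (6 * δ * bondL1 Y p) ^ 2) ≤ 12 * δ * Real.sqrt (∑ p ∈ Wn, bondSq Y p) := by
    rw [hL, Real.sqrt_mul (sq_nonneg _), Real.sqrt_sq h6δ]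
    have h1 : Real.sqrt (∑ p ∈ Wn, bondL1 Y p ^ 2) ≤ 2 * Real.sqrt (∑ p ∈ Wn, bondSq Y p) := by
      rw [← hsqrt4, ← Real.sqrt_mul (by norm_num : (0:ℝ) ≤ 4)]
      exact Real.sqrt_le_sqrt hY4
    calc 6 * δ * Real.sqrt (∑ p ∈ Wn, bondL1 Y p ^ 2) ≤ 6 * δ * (2 * Real.sqrt (∑ p ∈ Wn, bondSq Y p)) :=
          mul_le_mul_of_nonneg_left h1 h6δ
      _ = 12 * δ * Real.sqrt (∑ p ∈ Wn, bondSq Y p) := by ring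
  linarith [hstep1, hstep2, hbond]

/-- **CURL TRANSPORT ON THE TORUS**: for unitary `W`, skew `X` with `‖X(b)‖ ≤ α`, `δ := e^{|t|α} − 1`, `M ≥ 1` and an
`M`-periodic direction `Y`:  `√curlSq(W e^{tX}, Y) ≤ √curlSq(W, Y) + 24·√d·δ·√dirSq Y` (over `periodBox M`). [folklore] -/
theorem sqrt_curlSq_vary_le [Nonempty n] {W : Site d → Fin d → (Matrix n n ℂ)ˣ} (hW : IsUnitaryCfg W)
    {X : Site d → Fin d → Matrix n n ℂ} (hX : IsSkewDir X) {α : ℝ} (hα : 0 ≤ α) (hXα : ∀ x κ, ‖X x κ‖ ≤ α) (t : ℝ)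
    {M : ℕ} (hM : 1 ≤ M) {Y : Site d → Fin d → Matrix n n ℂ} (hY : IsPeriodicDir Y (M : ℤ)) :
    Real.sqrt (curlSq (vary W X t) Y (periodBox M))
      ≤ Real.sqrt (curlSq W Y (periodBox M))
        + 24 * Real.sqrt d * (Real.exp (|t| * α) - 1) * Real.sqrt (dirSq Y (periodBox M)) := by
  set δ := Real.exp (|t| * α) - 1 with hδ
  have hδ0 : 0 ≤ δ := by
    have : 0 ≤ |t| * α := mul_nonneg (abs_nonneg t) hα
    have := Real.one_le_exp this
    rw [hδ]; linarith
  have h := sqrt_sum_curl_sq_vary_le hW hX hα hXα t Y (plaqsOf (periodBox M))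
  rw [← curlSq_eq_sum_plaqsOf, ← curlSq_eq_sum_plaqsOf] at h
  have h4d : (0 : ℝ) ≤ 4 * (d : ℝ) := by positivity
  have hb : Real.sqrt (∑ p ∈ plaqsOf (periodBox M), bondSq Y p)
      ≤ Real.sqrt (4 * (d : ℝ)) * Real.sqrt (dirSq Y (periodBox M)) := by
    rw [← Real.sqrt_mul h4d]; exact Real.sqrt_le_sqrt (sum_plaqsOf_bondSq_le (n := n) hM hY)
  have hs4 : Real.sqrt (4 * (d : ℝ)) = 2 * Real.sqrt d := by
    rw [Real.sqrt_mul (by norm_num : (0:ℝ) ≤ 4), show (4 : ℝ) = 2 ^ 2 by norm_num, Real.sqrt_sq (by norm_num)]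
  rw [hs4] at hb
  have h12 : 0 ≤ 12 * δ := by positivity
  have : 12 * δ * Real.sqrt (∑ p ∈ plaqsOf (periodBox M), bondSq Y p)
      ≤ 12 * δ * (2 * Real.sqrt d * Real.sqrt (dirSq Y (periodBox M))) := mul_le_mul_of_nonneg_left hb h12
  linarith

/-! ## §3 The two-term bound at the FIXED background, and its weighted display -/

/-- **THE TWO-TERM `cont` BOUND AT THE FIXED BACKGROUND**: for unitary `W`, skew `X` with `‖X(b)‖ ≤ α`
(`δ := e^{|t|α} − 1`), the moving configuration `W_t := W·e^{tX}` with plaquette radius `a′ ≥ 0` on the period window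
(`M ≥ 1`), and `M`-periodic `Y, Z`:
`|hessSym W_t (perWin d M) Y Z| ≤ (√curlSq(W,Y) + 24√d·δ·√dirSq Y)·(√curlSq(W,Z) + 24√d·δ·√dirSq Z) + 48·d·a′·√dirSq Y·√dirSq Z`
— the Hessian at the moving point, measured at the FIXED background. [folklore] -/
theorem abs_hessSym_perWin_vary_le_twoTerm [Nonempty n] {W : Site d → Fin d → (Matrix n n ℂ)ˣ} (hW : IsUnitaryCfg W)
    {X : Site d → Fin d → Matrix n n ℂ} (hX : IsSkewDir X) {α : ℝ} (hα : 0 ≤ α) (hXα : ∀ x κ, ‖X x κ‖ ≤ α) (t : ℝ)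
    {M : ℕ} (hM : 1 ≤ M) {a' : ℝ} (ha0 : 0 ≤ a')
    (ha : ∀ p ∈ perWin d M, ‖((fhol (vary W X t) p : (Matrix n n ℂ)ˣ) : Matrix n n ℂ) - 1‖ ≤ a')
    {Y Z : Site d → Fin d → Matrix n n ℂ} (hY : IsPeriodicDir Y (M : ℤ)) (hZ : IsPeriodicDir Z (M : ℤ)) :
    |hessSym (vary W X t) (perWin d M) Y Z|
      ≤ (Real.sqrt (curlSq W Y (periodBox M)) + 24 * Real.sqrt d * (Real.exp (|t| * α) - 1) * Real.sqrt (dirSq Y (periodBox M)))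
          * (Real.sqrt (curlSq W Z (periodBox M)) + 24 * Real.sqrt d * (Real.exp (|t| * α) - 1) * Real.sqrt (dirSq Z (periodBox M)))
        + 48 * d * a' * (Real.sqrt (dirSq Y (periodBox M)) * Real.sqrt (dirSq Z (periodBox M))) := by
  have hVt : IsUnitaryCfg (vary W X t) := vary_isUnitaryCfg hW hX t
  have h0 := abs_hessSym_perWin_le_twoTerm hVt hM ha0 ha hY hZ
  have hcY := sqrt_curlSq_vary_le hW hX hα hXα t hM hY
  have hcZ := sqrt_curlSq_vary_le hW hX hα hXα t hM hZ
  have hY0 : 0 ≤ Real.sqrt (curlSq (vary W X t) Y (periodBox M)) := Real.sqrt_nonneg _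
  have hZ0 : 0 ≤ Real.sqrt (curlSq (vary W X t) Z (periodBox M)) := Real.sqrt_nonneg _
  have hprod : Real.sqrt (curlSq (vary W X t) Y (periodBox M)) * Real.sqrt (curlSq (vary W X t) Z (periodBox M))
      ≤ (Real.sqrt (curlSq W Y (periodBox M)) + 24 * Real.sqrt d * (Real.exp (|t| * α) - 1) * Real.sqrt (dirSq Y (periodBox M)))
          * (Real.sqrt (curlSq W Z (periodBox M)) + 24 * Real.sqrt d * (Real.exp (|t| * α) - 1) * Real.sqrt (dirSq Z (periodBox M))) :=
    mul_le_mul hcY hcZ hZ0 (hY0.trans hcY)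
  linarith

/-- `0 ≤ curlSq W Z F` (a sum of squares; stated as a lemma so that `positivity` is not run next to large hypotheses).
[folklore] -/
theorem curlSq_nonneg (W : Site d → Fin d → (Matrix n n ℂ)ˣ) (Z : Site d → Fin d → Matrix n n ℂ) (F : Finset (Site d)) :
    0 ≤ curlSq W Z F :=
  Finset.sum_nonneg fun _ _ => Finset.sum_nonneg fun _ _ => sq_nonneg _

/-- `0 ≤ dirSq Z F`. [folklore] -/
theorem dirSq_nonneg (Z : Site d → Fin d → Matrix n n ℂ) (F : Finset (Site d)) : 0 ≤ dirSq Z F :=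
  Finset.sum_nonneg fun _ _ => Finset.sum_nonneg fun _ _ => sq_nonneg _

/-- Real arithmetic of the weighted display: dominations `c ≤ N`, `e ≤ s·N` turn the two-term bound into
`[(1 + D·δ·s)² + A·s²]·N_Y·N_Z`. [folklore] -/
theorem twoTerm_weighted_arith {B cY cZ eY eZ NY NZ D δ A s : ℝ} (hs : 0 < s) (hD : 0 ≤ D) (hδ : 0 ≤ δ) (hA : 0 ≤ A)
    (hcZ : 0 ≤ cZ) (heZ : 0 ≤ eZ) (hNY : 0 ≤ NY)
    (h1 : cY ≤ NY) (h2 : cZ ≤ NZ) (h3 : eY ≤ s * NY) (h4 : eZ ≤ s * NZ)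
    (hB : B ≤ (cY + D * δ * eY) * (cZ + D * δ * eZ) + A * (eY * eZ)) :
    B ≤ ((1 + D * δ * s) ^ 2 + A * s ^ 2) * NY * NZ := by
  have hDδ : 0 ≤ D * δ := mul_nonneg hD hδ
  have e1 : cY + D * δ * eY ≤ (1 + D * δ * s) * NY := by nlinarith
  have e2 : cZ + D * δ * eZ ≤ (1 + D * δ * s) * NZ := by nlinarith
  have e0 : 0 ≤ cZ + D * δ * eZ := by positivity
  have hf : 0 ≤ (1 + D * δ * s) * NY := by positivity
  have e3 : (cY + D * δ * eY) * (cZ + D * δ * eZ) ≤ ((1 + D * δ * s) * NY) * ((1 + D * δ * s) * NZ) :=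
    mul_le_mul e1 e2 e0 hf
  have e4 : eY * eZ ≤ (s * NY) * (s * NZ) := mul_le_mul h3 h4 heZ (by positivity)
  have e5 : A * (eY * eZ) ≤ A * ((s * NY) * (s * NZ)) := mul_le_mul_of_nonneg_left e4 hA
  calc B ≤ (cY + D * δ * eY) * (cZ + D * δ * eZ) + A * (eY * eZ) := hB
    _ ≤ ((1 + D * δ * s) * NY) * ((1 + D * δ * s) * NZ) + A * ((s * NY) * (s * NZ)) := add_le_add e3 e5
    _ = ((1 + D * δ * s) ^ 2 + A * s ^ 2) * NY * NZ := by ring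

/-- `√c ≤ √(c + e∕s²)` and `√e ≤ s·√(c + e∕s²)` for `c, e ≥ 0`, `s > 0`. [folklore] -/
theorem sqrt_le_weighted {c e s : ℝ} (hc : 0 ≤ c) (he : 0 ≤ e) (hs : 0 < s) :
    Real.sqrt c ≤ Real.sqrt (c + e / s ^ 2) ∧ Real.sqrt e ≤ s * Real.sqrt (c + e / s ^ 2) := by
  refine ⟨Real.sqrt_le_sqrt (le_add_of_nonneg_right (by positivity)), ?_⟩
  have h1 : e ≤ s ^ 2 * (c + e / s ^ 2) := by
    rw [mul_add, mul_div_cancel₀ e (pow_ne_zero 2 hs.ne')]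
    nlinarith [sq_nonneg s]
  calc Real.sqrt e ≤ Real.sqrt (s ^ 2 * (c + e / s ^ 2)) := Real.sqrt_le_sqrt h1
    _ = s * Real.sqrt (c + e / s ^ 2) := by
        rw [Real.sqrt_mul (sq_nonneg s), Real.sqrt_sq hs.le]

/-- **THE WEIGHTED DISPLAY (norm-agnostic; the weight written inline)**: in the setting of
`abs_hessSym_perWin_vary_le_twoTerm`, for every `s > 0` and provided `δ = e^{|t|α} − 1 ≥ 0` (e.g. `α ≥ 0`),
`|hessSym W_t (perWin d M) Y Z| ≤ [(1 + 24√d·δ·s)² + 48·d·a′·s²] · √(curlSq W Y + dirSq Y∕s²) · √(curlSq W Z + dirSq Z∕s²)`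
(sums over `periodBox M`).  With `s = L^k`: the constant is k-FREE as soon as `δ·L^k` and `a′·L^{2k}` are bounded —
the two displayed smallness data of the chart path.  No norm of the cell is defined or chosen here. [folklore] -/
theorem abs_hessSym_perWin_vary_le_weighted [Nonempty n] {W : Site d → Fin d → (Matrix n n ℂ)ˣ} (hW : IsUnitaryCfg W)
    {X : Site d → Fin d → Matrix n n ℂ} (hX : IsSkewDir X) {α : ℝ} (hα : 0 ≤ α) (hXα : ∀ x κ, ‖X x κ‖ ≤ α) (t : ℝ)
    {M : ℕ} (hM : 1 ≤ M) {a' : ℝ} (ha0 : 0 ≤ a')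
    (ha : ∀ p ∈ perWin d M, ‖((fhol (vary W X t) p : (Matrix n n ℂ)ˣ) : Matrix n n ℂ) - 1‖ ≤ a')
    {Y Z : Site d → Fin d → Matrix n n ℂ} (hY : IsPeriodicDir Y (M : ℤ)) (hZ : IsPeriodicDir Z (M : ℤ))
    {s : ℝ} (hs : 0 < s) :
    |hessSym (vary W X t) (perWin d M) Y Z|
      ≤ ((1 + 24 * Real.sqrt d * (Real.exp (|t| * α) - 1) * s) ^ 2 + 48 * d * a' * s ^ 2)
          * Real.sqrt (curlSq W Y (periodBox M) + dirSq Y (periodBox M) / s ^ 2)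
          * Real.sqrt (curlSq W Z (periodBox M) + dirSq Z (periodBox M) / s ^ 2) := by
  have hδ : 0 ≤ Real.exp (|t| * α) - 1 := by
    have h1 : 0 ≤ |t| * α := mul_nonneg (abs_nonneg t) hα
    linarith [Real.one_le_exp h1]
  have h := abs_hessSym_perWin_vary_le_twoTerm hW hX hα hXα t hM ha0 ha hY hZ
  obtain ⟨hY1, hY2⟩ := sqrt_le_weighted (curlSq_nonneg W Y (periodBox M)) (dirSq_nonneg Y (periodBox M)) hs
  obtain ⟨hZ1, hZ2⟩ := sqrt_le_weighted (curlSq_nonneg W Z (periodBox M)) (dirSq_nonneg Z (periodBox M)) hs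
  have hD : (0 : ℝ) ≤ 24 * Real.sqrt d := mul_nonneg (by norm_num) (Real.sqrt_nonneg _)
  have hA : (0 : ℝ) ≤ 48 * d * a' := mul_nonneg (mul_nonneg (by norm_num) (Nat.cast_nonneg d)) ha0
  exact twoTerm_weighted_arith hs hD hδ hA (Real.sqrt_nonneg _) (Real.sqrt_nonneg _) (Real.sqrt_nonneg _)
    hY1 hZ1 hY2 hZ2 h

/-! ## §4 Along the path of `RouteLeaves` (periodic directions), in `hessSym` and `HsPer` form -/

/-- **THE TWO-TERM `cont` ALONG A PATH**: for a unitary background `W`, a path of skew direction fields `Γ t` with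
`‖Γ t (b)‖ ≤ α`, `W_t := vary W (Γ t) 1` with plaquette radii `a′ t ≥ 0` on the period window, `M ≥ 1`: for every
`t ∈ [0,1]` and all `M`-periodic `Y, Z` (`δ := e^{α} − 1`),
`|HsPer W_t (perWin d M) M Y Z| ≤ (√curlSq(W,Y) + 24√d·δ·√dirSq Y)(√curlSq(W,Z) + 24√d·δ·√dirSq Z) + 48·d·(a′ t)·√dirSq Y·√dirSq Z`
— the shape of `RouteLeaves.cont` on periodic directions with the curl term at the FIXED background. [folklore] -/
theorem cont_twoTerm_periodic [Nonempty n] {W : Site d → Fin d → (Matrix n n ℂ)ˣ} (hW : IsUnitaryCfg W)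
    {Γ : ℝ → Site d → Fin d → Matrix n n ℂ} (hΓ : ∀ t, IsSkewDir (Γ t)) {α : ℝ} (hα : 0 ≤ α)
    (hΓα : ∀ t x κ, ‖Γ t x κ‖ ≤ α) {M : ℕ} (hM : 1 ≤ M) {a' : ℝ → ℝ} (ha0 : ∀ t, 0 ≤ a' t)
    (ha : ∀ t, ∀ p ∈ perWin d M, ‖((fhol (vary W (Γ t) 1) p : (Matrix n n ℂ)ˣ) : Matrix n n ℂ) - 1‖ ≤ a' t) :
    ∀ t ∈ Set.Icc (0 : ℝ) 1, ∀ Y Z : Site d → Fin d → Matrix n n ℂ,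
      IsPeriodicDir Y (M : ℤ) → IsPeriodicDir Z (M : ℤ) →
      |HsPer (vary W (Γ t) 1) (perWin d M) M Y Z|
        ≤ (Real.sqrt (curlSq W Y (periodBox M)) + 24 * Real.sqrt d * (Real.exp α - 1) * Real.sqrt (dirSq Y (periodBox M)))
            * (Real.sqrt (curlSq W Z (periodBox M)) + 24 * Real.sqrt d * (Real.exp α - 1) * Real.sqrt (dirSq Z (periodBox M)))
          + 48 * d * a' t * (Real.sqrt (dirSq Y (periodBox M)) * Real.sqrt (dirSq Z (periodBox M))) := by
  intro t _ Y Z hY hZ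
  rw [HsPer_apply_of_periodic _ _ _ hY hZ]
  have h := abs_hessSym_perWin_vary_le_twoTerm hW (hΓ t) hα (hΓα t) 1 hM (ha0 t) (ha t) hY hZ
  simpa only [abs_one, one_mul] using h

end

end Summit.QuantumFields.BalabanUV.T4Continuum.NE3EnergyHessContTwoTerm
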